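import Summits.Ventures.Crystal3D.Theorems.StickyWulffConstantNoReconstructionGainAxisBarlowFilm
import HarnessLib

/-!
# Single-family Barlow films beyond the `54.7°` cone, I: the polar slots as `±N ± τ` and the per-ball count

HONEST FRAMING. Part of the venture `Summits/Ventures/Crystal3D` (cell `crystal3d-full`), helper
`--supports` the crux `NoReconstructionGain` (stmt-Ventures-19144, route
`route-Ventures-StickyWulffConstant`), line `adhesion`; local bookkeeping for the rung
`windowBarlowFilm_adhesion` (`…WindowBarlowFilm`), continuing `…BasalBarlowFilm` / `…AxisBarlowLocal`
(the eighteen contact vectors of `B = Λ₀ ∪ (Λ₀ + w) ∪ (Λ₀ − w)`, all Barlow positions of the basal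
family of `Λ₀ = fccStacking 1 √(2/3)`).

* `polar_vectors_eq`, `basal_polar_or_inplane` — the twelve polar contact vectors of `B` are `±N ± τ`
  with `N = layerNormal √(2/3)` and `τ` in the hollow triple `{w, w − u, w − v}` (`u, v` the sites
  `(0,1,0)`, `(0,0,1)`; `hollow_triple_sum`: the triple sums to `0`; each has `‖τ‖² = 1/3`);
* `window_noGainPotential_core` — the per-ball lemma of the WINDOW regime in abstract form: along `ν`,
  `|⟪τ₀,ν⟫| < ⟪N',ν⟫ < ⟪τ₁,ν⟫` and `⟪τ₂,ν⟫ < −⟪N',ν⟫`.  Under the `ν`-height a ball whose partners sit on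
  three lines or at the slots `q ± N' ± τᵢ` has at most `1` weight-two partner above (`N' + τ₂`,
  `N' − τ₁` are `√(1/3)` apart) and at most `2` below (`−N' − τ₁, −N' − τ₀, −N' + τ₂, −N' + τ₀` conflict
  except in three compatible pairs), no level polar partner, hence `2·#below + #level ≤ 12`
  (`antipodal_noGainPotential_of_above` with six lines).

WHAT THIS IS NOT: any statement about the slab sample; rung F-C1 not moved.
-/

noncomputable section

namespace Summit.Ventures.Crystal3D.Theorems

open Summit.Ventures.Crystal3D Finset
open Literature.MathematicalPhysics.StatisticalMechanics (barlowPos barlowStacking fccStacking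
  barlowOffset triangularVec₁ triangularVec₂ layerNormal constHagg haggLabel_const barlowPos_apply_zero
  barlowPos_apply_one barlowPos_apply_two three_smul_barlowOffset orderedContacts contactDeficiency)
open scoped InnerProductSpace

/-! ### The polar contact vectors as `±N ± τ` -/

/-- `⟪N, ν⟫ = √(2/3) ν₃`. -/
theorem inner_layerNormal_left (ν : EuclideanSpace ℝ (Fin 3)) :
    ⟪layerNormal (Real.sqrt (2 / 3)), ν⟫_ℝ = Real.sqrt (2 / 3) * ν 2 := by
  rw [EuclideanSpace.inner_eq_star_dotProduct]
  simp only [star_trivial, dotProduct, Fin.sum_univ_three]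
  simp [layerNormal]
  ring

/-- The six polar lattice / twin-hollow contact vectors of `B` written as `±N ± τ`, `τ ∈ {w, w−u, w−v}`. -/
theorem polar_vectors_eq :
    barlowPos 1 (Real.sqrt (2 / 3)) constHagg 1 0 0 = layerNormal (Real.sqrt (2 / 3)) + barlowOffset 1 ∧
    barlowPos 1 (Real.sqrt (2 / 3)) constHagg (-1) 1 0 =
      -(layerNormal (Real.sqrt (2 / 3)) + (barlowOffset 1 - barlowPos 1 (Real.sqrt (2 / 3)) constHagg 0 1 0)) ∧
    barlowPos 1 (Real.sqrt (2 / 3)) constHagg (-1) 0 1 =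
      -(layerNormal (Real.sqrt (2 / 3)) + (barlowOffset 1 - barlowPos 1 (Real.sqrt (2 / 3)) constHagg 0 0 1)) ∧
    barlowPos 1 (Real.sqrt (2 / 3)) constHagg 1 (-1) (-1) + barlowOffset 1 =
      layerNormal (Real.sqrt (2 / 3)) - barlowOffset 1 ∧
    barlowPos 1 (Real.sqrt (2 / 3)) constHagg 1 0 (-1) + barlowOffset 1 =
      layerNormal (Real.sqrt (2 / 3)) - (barlowOffset 1 - barlowPos 1 (Real.sqrt (2 / 3)) constHagg 0 1 0) ∧
    barlowPos 1 (Real.sqrt (2 / 3)) constHagg 1 (-1) 0 + barlowOffset 1 =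
      layerNormal (Real.sqrt (2 / 3)) - (barlowOffset 1 - barlowPos 1 (Real.sqrt (2 / 3)) constHagg 0 0 1) := by
  refine ⟨?_, ?_, ?_, ?_, ?_, ?_⟩ <;>
  · ext i
    fin_cases i <;>
      simp [barlowPos, barlowOffset, triangularVec₁, triangularVec₂, layerNormal] <;> ring

/-- `w + (w − u) + (w − v) = 0`. -/
theorem hollow_triple_sum :
    barlowOffset 1 + (barlowOffset 1 - barlowPos 1 (Real.sqrt (2 / 3)) constHagg 0 1 0) +
      (barlowOffset 1 - barlowPos 1 (Real.sqrt (2 / 3)) constHagg 0 0 1) = 0 := by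
  ext i
  fin_cases i <;> simp [barlowPos, barlowOffset, triangularVec₁, triangularVec₂, layerNormal] <;> ring

/-- **The eighteen contact vectors of `B`: three in-plane lines or `±N ± τ`.**  Reformulation of
`basal_unit_vectors`. -/
theorem basal_polar_or_inplane {d : EuclideanSpace ℝ (Fin 3)}
    (hd : (∃ c ∈ ([((0 : ℤ), (1 : ℤ), (0 : ℤ)), (0, 0, 1), (1, 0, 0), (0, 1, -1), (-1, 1, 0), (-1, 0, 1)] :
        List (ℤ × ℤ × ℤ)),
        d = barlowPos 1 (Real.sqrt (2 / 3)) constHagg c.1 c.2.1 c.2.2 ∨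
        d = -barlowPos 1 (Real.sqrt (2 / 3)) constHagg c.1 c.2.1 c.2.2) ∨
      (∃ c ∈ ([((1 : ℤ), (-1 : ℤ), (-1 : ℤ)), (1, 0, -1), (1, -1, 0)] : List (ℤ × ℤ × ℤ)),
        d = barlowPos 1 (Real.sqrt (2 / 3)) constHagg c.1 c.2.1 c.2.2 + barlowOffset 1 ∨
        d = -(barlowPos 1 (Real.sqrt (2 / 3)) constHagg c.1 c.2.1 c.2.2 + barlowOffset 1))) :
    (∃ c ∈ ([((0 : ℤ), (1 : ℤ), (0 : ℤ)), (0, 0, 1), (0, 1, -1)] : List (ℤ × ℤ × ℤ)),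
        d = barlowPos 1 (Real.sqrt (2 / 3)) constHagg c.1 c.2.1 c.2.2 ∨
        d = -barlowPos 1 (Real.sqrt (2 / 3)) constHagg c.1 c.2.1 c.2.2) ∨
      ∃ τ ∈ ([barlowOffset 1, barlowOffset 1 - barlowPos 1 (Real.sqrt (2 / 3)) constHagg 0 1 0,
          barlowOffset 1 - barlowPos 1 (Real.sqrt (2 / 3)) constHagg 0 0 1] : List (EuclideanSpace ℝ (Fin 3))),
        d = layerNormal (Real.sqrt (2 / 3)) + τ ∨ d = layerNormal (Real.sqrt (2 / 3)) - τ ∨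
        d = -(layerNormal (Real.sqrt (2 / 3)) + τ) ∨ d = -(layerNormal (Real.sqrt (2 / 3)) - τ) := by
  obtain ⟨e1, e2, e3, e4, e5, e6⟩ := polar_vectors_eq
  rcases hd with ⟨c, hc, hdc⟩ | ⟨c, hc, hdc⟩
  · simp only [List.mem_cons, List.mem_nil_iff, or_false] at hc
    rcases hc with rfl | rfl | rfl | rfl | rfl | rfl
    · exact Or.inl ⟨(0, 1, 0), by simp, hdc⟩
    · exact Or.inl ⟨(0, 0, 1), by simp, hdc⟩
    · right
      refine ⟨barlowOffset 1, by simp, ?_⟩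
      rcases hdc with h | h
      · exact Or.inl (by rw [h]; exact e1)
      · exact Or.inr (Or.inr (Or.inl (by rw [h, e1])))
    · exact Or.inl ⟨(0, 1, -1), by simp, hdc⟩
    · right
      refine ⟨barlowOffset 1 - barlowPos 1 (Real.sqrt (2 / 3)) constHagg 0 1 0, by simp, ?_⟩
      rcases hdc with h | h
      · exact Or.inr (Or.inr (Or.inl (by rw [h]; exact e2)))
      · exact Or.inl (by rw [h, e2, neg_neg])
    · right
      refine ⟨barlowOffset 1 - barlowPos 1 (Real.sqrt (2 / 3)) constHagg 0 0 1, by simp, ?_⟩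
      rcases hdc with h | h
      · exact Or.inr (Or.inr (Or.inl (by rw [h]; exact e3)))
      · exact Or.inl (by rw [h, e3, neg_neg])
  · simp only [List.mem_cons, List.mem_nil_iff, or_false] at hc
    rcases hc with rfl | rfl | rfl
    · right
      refine ⟨barlowOffset 1, by simp, ?_⟩
      rcases hdc with h | h
      · exact Or.inr (Or.inl (by rw [h]; exact e4))
      · exact Or.inr (Or.inr (Or.inr (by rw [h, e4])))
    · right
      refine ⟨barlowOffset 1 - barlowPos 1 (Real.sqrt (2 / 3)) constHagg 0 1 0, by simp, ?_⟩
      rcases hdc with h | h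
      · exact Or.inr (Or.inl (by rw [h]; exact e5))
      · exact Or.inr (Or.inr (Or.inr (by rw [h, e5])))
    · right
      refine ⟨barlowOffset 1 - barlowPos 1 (Real.sqrt (2 / 3)) constHagg 0 0 1, by simp, ?_⟩
      rcases hdc with h | h
      · exact Or.inr (Or.inl (by rw [h]; exact e6))
      · exact Or.inr (Or.inr (Or.inr (by rw [h, e6])))

/-! ### The per-ball lemma -/

/-- **(T2) at a ball of a single-family Barlow film in the window regime — abstract core.**  `X` a
unit packing, `P ⊆ X`, `q` a ball each of whose partners lies on one of three lines through `q`
(directions `e c`, `c` in a three-element list) or at a polar slot `q ± N' ± τ` with `τ ∈ {τ₀, τ₁, τ₂}`,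
where `‖τᵢ‖² = 1/3`, `τ₀ + τ₁ + τ₂ = 0`, and along `ν`: `|⟪τ₀,ν⟫| < ⟪N',ν⟫ < ⟪τ₁,ν⟫`, `⟪τ₂,ν⟫ < −⟪N',ν⟫`.
`Φ` ordered like `⟪·,ν⟫` on the film partners of `q`, substrate partners strictly `ν`-below `q`.  Then
`#below + #plug ≤ (12 − deg q) + #above`. -/
theorem window_noGainPotential_core (X P : Finset (EuclideanSpace ℝ (Fin 3)))
    (hX : ∀ p ∈ X, ∀ q ∈ X, p ≠ q → 1 ≤ dist p q) (hPX : P ⊆ X)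
    (q : EuclideanSpace ℝ (Fin 3)) (Φ : EuclideanSpace ℝ (Fin 3) → ℤ)
    (ν N' τ₀ τ₁ τ₂ : EuclideanSpace ℝ (Fin 3)) (E3 : List (EuclideanSpace ℝ (Fin 3))) (hE3 : E3.length ≤ 3)
    (hn₀ : ‖τ₀‖ ^ 2 = 1 / 3) (hn₁ : ‖τ₁‖ ^ 2 = 1 / 3) (hn₂ : ‖τ₂‖ ^ 2 = 1 / 3)
    (hsum : τ₀ + τ₁ + τ₂ = 0)
    (h₀ : |⟪τ₀, ν⟫_ℝ| < ⟪N', ν⟫_ℝ) (h₁ : ⟪N', ν⟫_ℝ < ⟪τ₁, ν⟫_ℝ) (h₂ : ⟪τ₂, ν⟫_ℝ < -⟪N', ν⟫_ℝ)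
    (hlt : ∀ x ∈ X \ P, dist q x = 1 → (Φ x < Φ q ↔ ⟪x, ν⟫_ℝ < ⟪q, ν⟫_ℝ))
    (heq : ∀ x ∈ X \ P, dist q x = 1 → (Φ x = Φ q ↔ ⟪x, ν⟫_ℝ = ⟪q, ν⟫_ℝ))
    (hplug : ∀ p ∈ P, dist q p = 1 → ⟪p, ν⟫_ℝ < ⟪q, ν⟫_ℝ)
    (hdir : ∀ x ∈ X, dist q x = 1 →
      (∃ e ∈ E3, x - q = e ∨ x - q = -e) ∨
      (∃ τ ∈ [τ₀, τ₁, τ₂], x - q = N' + τ ∨ x - q = N' - τ ∨ x - q = -(N' + τ) ∨ x - q = -(N' - τ))) :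
    (((X \ P).filter fun x => dist q x = 1 ∧ Φ x < Φ q).card : ℤ)
        + ((P.filter fun p => dist q p = 1).card : ℤ)
      ≤ (12 - ((X.filter fun x => dist q x = 1).card : ℤ))
        + (((X \ P).filter fun x => dist q x = 1 ∧ Φ q < Φ x).card : ℤ) := by
  classical
  -- the six `ν`-negative polar slots
  set sU1 : EuclideanSpace ℝ (Fin 3) := N' + τ₂ with hsU1
  set sU2 : EuclideanSpace ℝ (Fin 3) := N' - τ₁ with hsU2
  set sA : EuclideanSpace ℝ (Fin 3) := -(N' + τ₁) with hsA
  set sB : EuclideanSpace ℝ (Fin 3) := -(N' + τ₀) with hsB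
  set sC : EuclideanSpace ℝ (Fin 3) := -(N' - τ₂) with hsC
  set sD : EuclideanSpace ℝ (Fin 3) := -(N' - τ₀) with hsD
  -- sums of two hollow vectors
  have h01 : τ₀ + τ₁ = -τ₂ := by rw [← sub_eq_zero]; rw [← hsum]; abel
  have h02 : τ₀ + τ₂ = -τ₁ := by rw [← sub_eq_zero]; rw [← hsum]; abel
  have h12 : τ₁ + τ₂ = -τ₀ := by rw [← sub_eq_zero]; rw [← hsum]; abel
  -- the four conflicts (squared distance `1/3`)
  have cU : ‖sU1 - sU2‖ ^ 2 = 1 / 3 := by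
    rw [hsU1, hsU2, show N' + τ₂ - (N' - τ₁) = τ₁ + τ₂ by abel, h12, norm_neg, hn₀]
  have cAC : ‖sA - sC‖ ^ 2 = 1 / 3 := by
    rw [hsA, hsC, show -(N' + τ₁) - -(N' - τ₂) = -(τ₁ + τ₂) by abel, h12, neg_neg, hn₀]
  have cAD : ‖sA - sD‖ ^ 2 = 1 / 3 := by
    rw [hsA, hsD, show -(N' + τ₁) - -(N' - τ₀) = -(τ₀ + τ₁) by abel, h01, neg_neg, hn₂]
  have cBC : ‖sB - sC‖ ^ 2 = 1 / 3 := by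
    rw [hsB, hsC, show -(N' + τ₀) - -(N' - τ₂) = -(τ₀ + τ₂) by abel, h02, neg_neg, hn₁]
  have conflict : ∀ {a b : EuclideanSpace ℝ (Fin 3)}, ‖a - b‖ ^ 2 = 1 / 3 →
      q + a ∈ X → q + b ∈ X → False := by
    intro a b h ha hb
    exact not_both_mem_of_norm_sq hX (a := q + a) (b := q + b) (by rw [add_sub_add_left_eq_sub]; exact h) ha hb
  have hxq : ∀ x d : EuclideanSpace ℝ (Fin 3), x - q = d → x = q + d := fun x d h => by rw [← h]; abel
  have occ : ∀ x d : EuclideanSpace ℝ (Fin 3), x ∈ X → x - q = d → q + d ∈ X :=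
    fun x d hx h => by rw [← hxq x d h]; exact hx
  -- the `ν`-negative polar partners of `q`
  set D := X.filter fun x => dist q x = 1 ∧
    (x - q = sU1 ∨ x - q = sU2 ∨ x - q = sA ∨ x - q = sB ∨ x - q = sC ∨ x - q = sD) with hD
  set Dup := D.filter fun x => x - q = sU1 ∨ x - q = sU2 with hDup
  set Ddn := D.filter fun x => x - q = sA ∨ x - q = sB ∨ x - q = sC ∨ x - q = sD with hDdn
  have memD : ∀ x ∈ D, x ∈ X := fun x hx => (mem_filter.1 hx).1
  have hDsplit : D.card ≤ Dup.card + Ddn.card := by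
    have hsub : D ⊆ Dup ∪ Ddn := by
      intro x hx
      rcases (mem_filter.1 hx).2.2 with h | h | h | h | h | h
      · exact mem_union.2 (Or.inl (mem_filter.2 ⟨hx, Or.inl h⟩))
      · exact mem_union.2 (Or.inl (mem_filter.2 ⟨hx, Or.inr h⟩))
      · exact mem_union.2 (Or.inr (mem_filter.2 ⟨hx, Or.inl h⟩))
      · exact mem_union.2 (Or.inr (mem_filter.2 ⟨hx, Or.inr (Or.inl h)⟩))
      · exact mem_union.2 (Or.inr (mem_filter.2 ⟨hx, Or.inr (Or.inr (Or.inl h))⟩))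
      · exact mem_union.2 (Or.inr (mem_filter.2 ⟨hx, Or.inr (Or.inr (Or.inr h))⟩))
    exact (card_le_card hsub).trans (card_union_le _ _)
  have two : ∀ (S : Finset (EuclideanSpace ℝ (Fin 3))) (d₁ d₂ : EuclideanSpace ℝ (Fin 3)),
      (∀ x ∈ S, x - q = d₁ ∨ x - q = d₂) → S.card ≤ 2 := by
    intro S d₁ d₂ h
    have hsub : S ⊆ {q + d₁, q + d₂} := by
      intro x hx
      rcases h x hx with e | e
      · rw [hxq x d₁ e]; simp
      · rw [hxq x d₂ e]; simp
    exact (card_le_card hsub).trans (card_insert_le _ _ |>.trans (by simp))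
  have one : ∀ (S : Finset (EuclideanSpace ℝ (Fin 3))) (d₁ : EuclideanSpace ℝ (Fin 3)),
      (∀ x ∈ S, x - q = d₁) → S.card ≤ 1 := by
    intro S d₁ h
    have hsub : S ⊆ {q + d₁} := by
      intro x hx; rw [hxq x d₁ (h x hx)]; simp
    exact (card_le_card hsub).trans (by simp)
  -- up: at most one
  have hup : Dup.card ≤ 1 := by
    by_cases h1 : q + sU1 ∈ X
    · refine one Dup sU1 fun x hx => ?_
      obtain ⟨hxD, h⟩ := mem_filter.1 hx
      rcases h with h | h
      · exact h
      · exact (conflict cU h1 (occ x sU2 (memD x hxD) h)).elim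
    · refine one Dup sU2 fun x hx => ?_
      obtain ⟨hxD, h⟩ := mem_filter.1 hx
      rcases h with h | h
      · exact (h1 (occ x sU1 (memD x hxD) h)).elim
      · exact h
  -- down: at most two
  have hdn : Ddn.card ≤ 2 := by
    by_cases ha : q + sA ∈ X
    · refine two Ddn sA sB fun x hx => ?_
      obtain ⟨hxD, h⟩ := mem_filter.1 hx
      rcases h with h | h | h | h
      · exact Or.inl h
      · exact Or.inr h
      · exact (conflict cAC ha (occ x sC (memD x hxD) h)).elim
      · exact (conflict cAD ha (occ x sD (memD x hxD) h)).elim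
    · by_cases hc : q + sC ∈ X
      · refine two Ddn sC sD fun x hx => ?_
        obtain ⟨hxD, h⟩ := mem_filter.1 hx
        rcases h with h | h | h | h
        · exact (ha (occ x sA (memD x hxD) h)).elim
        · exact (conflict cBC (occ x sB (memD x hxD) h) hc).elim
        · exact Or.inl h
        · exact Or.inr h
      · refine two Ddn sB sD fun x hx => ?_
        obtain ⟨hxD, h⟩ := mem_filter.1 hx
        rcases h with h | h | h | h
        · exact (ha (occ x sA (memD x hxD) h)).elim
        · exact Or.inl h
        · exact (hc (occ x sC (memD x hxD) h)).elim
        · exact Or.inr h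
  have hD3 : D.card ≤ 3 := by omega
  -- the slot set: three in-plane directions and the (at most three) negative polar directions
  set W3 : Finset (EuclideanSpace ℝ (Fin 3)) := E3.toFinset with hW3
  have hW3card : W3.card ≤ 3 := by rw [hW3]; exact (List.toFinset_card_le _).trans hE3
  set WD := D.image fun x => x - q with hWD
  have hWDcard : WD.card ≤ 3 := card_image_le.trans hD3
  set W := W3 ∪ WD with hW
  have hWcard : W.card ≤ 6 := (card_union_le _ _).trans (by omega)
  -- apply the antipodal-lines lemma with `R` = film partners that are not ν-above, `f = ⟪·,ν⟫`
  set R := (X \ P).filter fun x => ⟪x, ν⟫_ℝ ≤ ⟪q, ν⟫_ℝ with hR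
  have hRsub : R ⊆ X \ P := filter_subset _ _
  refine antipodal_noGainPotential_of_above X P R hPX hRsub q Φ (fun y => ⟪y, ν⟫_ℝ)
    (fun x hx hd => ?_) (fun x hx hd => hlt x (hRsub hx) hd) (fun x hx hd => heq x (hRsub hx) hd)
    hplug (fun w => ?_) W hWcard (fun x hx hd hxR => ?_)
  · -- outside `R`: ν-above, hence Φ-above
    have hxQ : x ∈ X \ P := (mem_sdiff.1 hx).1
    have hnot : ¬ ⟪x, ν⟫_ℝ ≤ ⟪q, ν⟫_ℝ := fun hle => (mem_sdiff.1 hx).2 (mem_filter.2 ⟨hxQ, hle⟩)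
    have h1 : ¬ Φ x < Φ q := fun hl => hnot ((hlt x hxQ hd).1 hl).le
    have h2 : ¬ Φ x = Φ q := fun he => hnot ((heq x hxQ hd).1 he).le
    omega
  · -- a linear function is midpoint-affine
    rw [inner_add_left, inner_sub_left]; linarith
  · -- every non-exempt partner is on a line of `W`
    have hνx : ⟪x - q, ν⟫_ℝ ≤ 0 := by
      by_cases hxP : x ∈ P
      · rw [inner_sub_left]; linarith [hplug x hxP hd]
      · have hxR' : x ∈ R := by
          by_contra hxR'; exact hxR (mem_sdiff.2 ⟨mem_sdiff.2 ⟨hx, hxP⟩, hxR'⟩)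
        have hle := (mem_filter.1 hxR').2
        rw [inner_sub_left]; linarith
    rcases hdir x hx hd with ⟨e, he, hex⟩ | ⟨τ, hτ, hτx⟩
    · refine ⟨e, ?_, ?_⟩
      · rw [hW, mem_union]; left; rw [hW3, List.mem_toFinset]; exact he
      · rcases hex with h | h
        · exact Or.inl (hxq x e h)
        · exact Or.inr (by rw [hxq x (-e) h, sub_eq_add_neg])
    · -- polar: the sign conditions leave exactly the six negative slots
      have key : x - q = sU1 ∨ x - q = sU2 ∨ x - q = sA ∨ x - q = sB ∨ x - q = sC ∨ x - q = sD := by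
        have h0l : -⟪N', ν⟫_ℝ < ⟪τ₀, ν⟫_ℝ := by have := neg_abs_le ⟪τ₀, ν⟫_ℝ; linarith [abs_nonneg ⟪τ₀, ν⟫_ℝ]
        have h0r : ⟪τ₀, ν⟫_ℝ < ⟪N', ν⟫_ℝ := lt_of_le_of_lt (le_abs_self _) h₀
        have hN0 : 0 < ⟪N', ν⟫_ℝ := lt_of_le_of_lt (abs_nonneg _) h₀
        simp only [List.mem_cons, List.mem_nil_iff, or_false] at hτ
        rcases hτ with rfl | rfl | rfl <;> rcases hτx with h | h | h | h <;>
          rw [h] at hνx <;>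
          simp only [inner_add_left, inner_sub_left, inner_neg_left] at hνx
        -- τ₀: N+τ₀ (pos) , N-τ₀ (pos), -(N+τ₀) = sB ✓, -(N-τ₀) = sD ✓
        · exfalso; linarith
        · exfalso; linarith
        · exact Or.inr (Or.inr (Or.inr (Or.inl h)))
        · exact Or.inr (Or.inr (Or.inr (Or.inr (Or.inr h))))
        -- τ₁: N+τ₁ (pos), N-τ₁ = sU2 ✓, -(N+τ₁) = sA ✓, -(N-τ₁) (pos)
        · exfalso; linarith
        · exact Or.inr (Or.inl h)
        · exact Or.inr (Or.inr (Or.inl h))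
        · exfalso; linarith
        -- τ₂: N+τ₂ = sU1 ✓, N-τ₂ (pos), -(N+τ₂) (pos), -(N-τ₂) = sC ✓
        · exact Or.inl h
        · exfalso; linarith
        · exfalso; linarith
        · exact Or.inr (Or.inr (Or.inr (Or.inr (Or.inl h))))
      have hxD : x ∈ D := mem_filter.2 ⟨hx, hd, key⟩
      refine ⟨x - q, ?_, Or.inl (by abel)⟩
      rw [hW, mem_union]; right
      rw [hWD]; exact mem_image.2 ⟨x, hxD, rfl⟩

end Summit.Ventures.Crystal3D.Theorems

end
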